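import Summits.BirchSwinnertonDyer.Rank1Residual.Additive.X3BranchSIntegersModNine
import Literature.NumberTheory.EllipticCurves.ZpExtension
import Literature.NumberTheory.GaloisRepresentations.AbsGaloisGroup
import Mathlib.NumberTheory.NumberField.Basic
import HarnessLib

/-!
# X3, the DEGENERATE rows, class-level count: DATA EXTRACTION for the Kummer family of a layer —
# the congruence `u·D³ = 1 + 9T` with `T` INTEGRAL from «`u` is a cube mod `9R`», integral bases with
# structure constants, and Galois-stability of the layers (cell `bsd-eis`, seat `bsd-eis-x3` gen 9;
# glue L1–L4 of the assembly U5 of x3-MEMO-11; route K1 `AdditiveBranchIMC`, crux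
# `GordTwoRankZeroOffCaseOne` — supports only)

HONEST FRAMING (`run/shared/lean/pub/bsd-eis/README.md` §4): THEOREMS ONLY (no `def`, no named fact,
no `sorry`); nothing is booked; no label, tier or count of record moves.

## What
* §1 `KummerFamily.exists_congruence_of_mk_mem_range` — in any commutative ring `R`: if the unit `u`
  is a cube in `(R/9R)ˣ` then `u·d³ = 1 + 9t` for some `d, t ∈ R`.
* §2 `KummerFamily.exists_int_cube_mul_eq` — for the `S`-integers `R` at the primes of `m₀`, `3 ∤ m₀`:
  every `t ∈ R` admits `c ∈ ℤ`, `c ≠ 0`, and `T ∈ 𝓞_K` with `c³(1 + 9t) = 1 + 9T` (`c = (α m₀)^k` with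
  `α m₀ ≡ 1 (mod 9)`) — so `u·(cd)³ = 1 + 9T` with `T` INTEGRAL, the shape consumed by
  `KummerLayerClasses.exists_goodRoot_of_congruence`.
* §3 `KummerFamily.exists_basis_structureConstants` — an integral basis `b` of `𝓞_K` indexed by `Fin n`
  with integer structure constants `b_i b_j = Σ_k μ_{kij} b_k` and integer coordinates for every
  element.
* §4 `ZpExtension.mem_layer_iff_forall_smul_eq`, `ZpExtension.smul_mem_layer` — `x ∈ ℚ_N` iff `x` is
  fixed by `κ⁻¹(p^N ℤ_p)`, and `ℚ_N` is `Γ_ℚ`-stable (normality of the layer subgroup).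
References: [NeukirchANT1999] Ch. I (2.9)–(2.10) (integral bases), (11.6); [Washington1997] §13.1.
-/

set_option autoImplicit false

noncomputable section

open scoped Classical NumberField

namespace Summit.BirchSwinnertonDyer.Rank1Residual.Additive

namespace KummerFamily

open NumberField IsDedekindDomain

/-! ### §1 From «cube mod `9`» to a congruence -/

/-- **If the unit `u` of `R` is a cube in `(R/9R)ˣ` then `u·d³ = 1 + 9t` in `R`.** [folklore] -/
theorem exists_congruence_of_mk_mem_range {R : Type*} [CommRing R] (u : Rˣ)
    (hu : Units.map (Ideal.Quotient.mk (Ideal.span {(9 : R)})).toMonoidHom u ∈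
      (@powMonoidHom (R ⧸ Ideal.span {(9 : R)})ˣ _ 3).range) :
    ∃ d t : R, (u : R) * d ^ 3 = 1 + 9 * t := by
  obtain ⟨c, hc⟩ := hu
  obtain ⟨d, hd⟩ := Ideal.Quotient.mk_surjective ((c⁻¹ : (R ⧸ Ideal.span {(9 : R)})ˣ) : R ⧸ Ideal.span {(9 : R)})
  have h1 : Ideal.Quotient.mk (Ideal.span {(9 : R)}) ((u : R) * d ^ 3) = 1 := by
    rw [map_mul, map_pow, hd]
    have hcu : ((c : (R ⧸ Ideal.span {(9 : R)})ˣ) : R ⧸ _) ^ 3 =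
        Ideal.Quotient.mk (Ideal.span {(9 : R)}) (u : R) := by
      have := congrArg (fun z : (R ⧸ Ideal.span {(9 : R)})ˣ ↦ (z : R ⧸ Ideal.span {(9 : R)})) hc
      simpa using this
    rw [← hcu, ← mul_pow, Units.mul_inv, one_pow]
  rw [← (Ideal.Quotient.mk _).map_one, Ideal.Quotient.eq, Ideal.mem_span_singleton'] at h1
  obtain ⟨t, ht⟩ := h1
  exact ⟨d, t, by linear_combination -ht⟩

/-! ### §2 Making the remainder integral -/

variable {K : Type*} [Field K] [NumberField K]

/-- **`c³ (1 + 9t) = 1 + 9T` with `c ∈ ℤ ∖ 0`, `T ∈ 𝓞_K`** for every `S`-integer `t` at the primes of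
`m₀`, `3 ∤ m₀`: take `c = (α m₀)^k` where `α m₀ ≡ 1 (mod 9)` and `m₀^k` clears the denominator of `t`.
[cite: NeukirchANT1999, Ch. I (11.6)] -/
theorem exists_int_cube_mul_eq {m₀ : ℕ} (hm₀ : m₀ ≠ 0) (h3 : ¬ 3 ∣ m₀)
    (t : ({v : HeightOneSpectrum (𝓞 K) | (m₀ : 𝓞 K) ∈ v.asIdeal} : Set _).integer K) :
    ∃ (c : ℤ) (T : 𝓞 K), c ≠ 0 ∧ (c : K) ^ 3 * (1 + 9 * (t : K)) = 1 + 9 * algebraMap (𝓞 K) K T := by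
  obtain ⟨k, y, hy⟩ := exists_pow_mul_mem_range (K := K) hm₀ t
  have hcop : IsCoprime (m₀ : ℤ) 9 := by
    rw [Int.isCoprime_iff_gcd_eq_one]
    have : Nat.Coprime m₀ 9 := by
      rw [show (9 : ℕ) = 3 ^ 2 by norm_num]
      exact (Nat.Coprime.pow_right 2 ((Nat.Prime.coprime_iff_not_dvd Nat.prime_three).mpr h3).symm)
    exact_mod_cast this
  obtain ⟨α, β, hαβ⟩ := hcop
  -- `(α m₀)^{3k} = 1 + 9 w`
  have hdiv : (9 : ℤ) ∣ (α * m₀) ^ (3 * k) - 1 := by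
    have h1 : (9 : ℤ) ∣ α * (m₀ : ℤ) - 1 := ⟨-β, by linear_combination hαβ⟩
    exact h1.trans (by simpa using sub_dvd_pow_sub_pow (α * (m₀ : ℤ)) 1 (3 * k))
  obtain ⟨w, hw⟩ := hdiv
  have hαm0 : α * (m₀ : ℤ) ≠ 0 := by
    intro h0
    have : (9 : ℤ) ∣ -1 := ⟨w, by rw [← hw, h0, zero_pow (by omega)]; ring⟩
    omega
  refine ⟨(α * m₀) ^ k, w + (α ^ (3 * k) * (m₀ : ℤ) ^ (2 * k)) • y, pow_ne_zero _ hαm0, ?_⟩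
  have hwK : ((α : K) * (m₀ : K)) ^ (3 * k) - 1 = 9 * (w : K) := by exact_mod_cast hw
  rw [map_add, map_zsmul, zsmul_eq_mul, hy, map_intCast]
  push_cast
  linear_combination hwK

/-! ### §3 Integral bases with structure constants -/

/-- **An integral basis with integer structure constants and integer coordinates**, indexed by
`Fin n`, `n = [K : ℚ]`. [cite: NeukirchANT1999, Ch. I (2.9)–(2.10)] -/
theorem exists_basis_structureConstants (K : Type*) [Field K] [NumberField K] :
    ∃ (n : ℕ) (b : Fin n → 𝓞 K) (μ : Fin n → Fin n → Fin n → ℤ),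
      n = Module.finrank ℚ K ∧
      (∀ i j, b i * b j = ∑ k, μ k i j • b k) ∧
      (∀ x : 𝓞 K, ∃ t : Fin n → ℤ, x = ∑ k, t k • b k) ∧
      LinearIndependent ℤ b := by
  let b₀ := NumberField.RingOfIntegers.basis K
  let e := Fintype.equivFin (Module.Free.ChooseBasisIndex ℤ (𝓞 K))
  let b := b₀.reindex e
  refine ⟨_, b, fun k i j ↦ b.repr (b i * b j) k, ?_, fun i j ↦ ?_, fun x ↦ ⟨fun k ↦ b.repr x k, ?_⟩,
    b.linearIndependent⟩
  · rw [← RingOfIntegers.rank K, Module.finrank_eq_card_basis b, Fintype.card_fin]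
  · conv_lhs => rw [← b.sum_repr (b i * b j)]
  · conv_lhs => rw [← b.sum_repr x]

end KummerFamily

end Summit.BirchSwinnertonDyer.Rank1Residual.Additive

/-! ### §4 The layers are `Γ_ℚ`-stable -/

namespace Literature.NumberTheory.EllipticCurves.ZpExtension

open Field Literature.NumberTheory.GaloisRepresentations

variable {p : ℕ} [Fact p.Prime] (κ : ZpExtension ℚ p)

/-- **`x ∈ ℚ_N ⟺ σ x = x` for all `σ ∈ κ⁻¹(p^N ℤ_p)`** (the layer is the fixed field).
[cite: Washington1997, §13.1] -/
theorem mem_layer_iff_forall_smul_eq (N : ℕ) (x : AlgebraicClosure ℚ) :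
    x ∈ κ.layer N ↔ ∀ σ ∈ κ.layerSubgroup N, σ • x = x := by
  rw [ZpExtension.layer, IntermediateField.mem_fixedField_iff]
  constructor
  · intro h σ hσ
    exact h _ (Subgroup.mem_map.mpr ⟨σ, hσ, rfl⟩)
  · rintro h f hf
    obtain ⟨σ, hσ, rfl⟩ := Subgroup.mem_map.mp hf
    exact h σ hσ

/-- **The layers are `Γ_ℚ`-stable**: `x ∈ ℚ_N ⟹ τ x ∈ ℚ_N` (the layer subgroup is normal).
[cite: Washington1997, §13.1] -/
theorem smul_mem_layer (N : ℕ) {x : AlgebraicClosure ℚ} (hx : x ∈ κ.layer N)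
    (τ : absoluteGaloisGroup ℚ) : τ • x ∈ κ.layer N := by
  rw [mem_layer_iff_forall_smul_eq] at hx ⊢
  intro σ hσ
  have hmem : τ⁻¹ * σ * τ ∈ κ.layerSubgroup N := by
    have := (κ.layerSubgroup_normal N).conj_mem σ hσ τ⁻¹
    rwa [inv_inv] at this
  calc σ • τ • x = τ • ((τ⁻¹ * σ * τ) • x) := by rw [mul_smul, mul_smul, smul_inv_smul]
    _ = τ • x := by rw [hx _ hmem]

end Literature.NumberTheory.EllipticCurves.ZpExtension

end
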